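import Literature.NumberTheory.Sieve.PolymathMkEpsCauchySchwarz

/-!
# Route `PolymathEpsThreeCeiling`, crux `GridBoundHigh` (stmt-Parity-19069): the RANK/ACTIVITY-resolved
# Cauchy–Schwarz weight family at `k = 3` — positivity and the pointwise bound (support lemmas)

The open stub `stub_cwCertsHigh` (skeleton `Cruxes/GridBoundHigh/Lines/birth.lean`) asks, for each `ε = j/80`,
`17 ≤ j ≤ 40`, for weights `w : Fin 3 → (Fin 3 → ℝ) → ℝ` on the enlarged simplex `(1+ε)·R₃` with four properties:
measurability, positivity on active atoms, unit fibre budgets, and the POINTWISE bound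
`∑_m 1[t_m > 0 ∧ ∑_{i≠m} t_i ≤ 1-ε] · w_m(t) ≤ Λ` (`Λ = 2(80+j)/(81+j)`) — the data of the tree's proved checker
`Literature.NumberTheory.Sieve.polymathFunctional_le_of_weights`.

This file introduces the weight FAMILY in which the prover hand's lattice programs (item evidence
`CENSUS-19069-orderone.md`, 2026-08-31) found certificates for every `j` with fibre-budget slack `1.7 %` (`j = 40`) to
`3.6 %` (`j = 17`), and proves — once, for all `j` and all parameter functions — the two `F`-independent ALGEBRAIC
conjuncts of the stub (positivity and the pointwise bound).  Plain order-one weights `w_m(t) = W(∑ t, t_m)` are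
provably insufficient for `j ≥ 20` (same evidence); the family below additionally reads two DISCRETE features of `t`:

* the number of active atoms `A(t) = #{i : t_i > 0 ∧ ∑_{j≠i} t_j ≤ 1-ε}` (`≤ 3`), and
* order indicators of `t_m` among the (active) atoms,

and is, with `σ = ∑ t` and parameter functions `c, αS, d₁, d₀, β : ℝ → ℝ` of `σ`:
`w_m(t) = Λ` if `A(t) ≤ 1`; `w_m(t) = (Λ - c σ) + (2 c σ - Λ)·1[t_m > t_i for every other ACTIVE i]` if `A(t) = 2`;
`w_m(t) = αS σ + β σ · t_m + d₁ σ · 1[t_m > t_i for some i ≠ m] + d₀ σ · 1[t_m > t_i for all i ≠ m]` if `A(t) = 3`.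
The pointwise bound then holds for EVERY `t : Fin 3 → ℝ` as soon as `0 ≤ Λ`, `Λ/2 ≤ c`, `d₀, d₁ ≥ 0` and the flatness
inequality `3 αS σ + β σ · σ + 2 d₁ σ + d₀ σ ≤ Λ` (`RankActivity.sum_indicator_weight_le`): at most one active atom is
strictly above all other active atoms, at most one atom is a strict maximum, and the minimal atom is above nobody.
Measurability of every `w_m` for measurable parameter functions (conjunct 1 of the stub) is
`RankActivity.measurable_weight` (appended section `Measurability`).  What remains of the stub in this family is the
fibre-budget inequality alone, an explicit two-parameter family of one-dimensional integrals of reciprocals of affine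
functions (the census, §F3).
No summit claim; support lemmas for stmt-Parity-19069 only.  Standard axioms.
-/

noncomputable section

open Finset

namespace Summit.Parity.GeneralizedHardyLittlewood.Theses.PolymathEpsThreeCeiling

namespace RankActivity

open Classical in
/-- The set of ACTIVE atoms of `t : Fin 3 → ℝ` for the `ε`-enlarged functional: those `i` with `t_i > 0` whose
two other coordinates sum to at most `1 - ε` (the indicator in `polymathFunctional_le_of_weights`' pointwise
hypothesis). -/
def actSet (ε : ℝ) (t : Fin 3 → ℝ) : Finset (Fin 3) :=
  univ.filter (fun i => 0 < t i ∧ ∑ j ∈ univ.erase i, t j ≤ 1 - ε)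

open Classical in
/-- `1` if `t_m` is strictly larger than every OTHER ACTIVE atom, else `0` (used when two atoms are active). -/
def topInd (ε : ℝ) (t : Fin 3 → ℝ) (m : Fin 3) : ℝ :=
  if ∀ i, i ≠ m → i ∈ actSet ε t → t i < t m then 1 else 0

open Classical in
/-- `1` if `t_m` is a strict maximum of `t`, else `0`. -/
def maxInd (t : Fin 3 → ℝ) (m : Fin 3) : ℝ :=
  if ∀ i, i ≠ m → t i < t m then 1 else 0

open Classical in
/-- `1` if `t_m` is strictly larger than SOME other atom (i.e. `t_m` is not a minimum), else `0`. -/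
def notMinInd (t : Fin 3 → ℝ) (m : Fin 3) : ℝ :=
  if ∃ i, i ≠ m ∧ t i < t m then 1 else 0

/-- The rank/activity-resolved weight family (module docstring): parameters `Λ` and `c, αS, d₁, d₀, β : ℝ → ℝ`
(functions of `σ = ∑ t`); `A(t) = #actSet`. -/
def weight (ε Λ : ℝ) (c αS d₁ d₀ β : ℝ → ℝ) (m : Fin 3) (t : Fin 3 → ℝ) : ℝ :=
  if (actSet ε t).card ≤ 1 then Λ
  else if (actSet ε t).card = 2 then
    (Λ - c (∑ i, t i)) + (2 * c (∑ i, t i) - Λ) * topInd ε t m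
  else αS (∑ i, t i) + β (∑ i, t i) * t m + d₁ (∑ i, t i) * notMinInd t m + d₀ (∑ i, t i) * maxInd t m

/-! ### The three counting facts -/

/-- At most one ACTIVE atom is strictly above every other active atom. -/
theorem sum_topInd_le_one (ε : ℝ) (t : Fin 3 → ℝ) : ∑ m ∈ actSet ε t, topInd ε t m ≤ 1 := by
  classical
  unfold topInd
  rw [Finset.sum_boole]
  have h : ((actSet ε t).filter (fun m => ∀ i, i ≠ m → i ∈ actSet ε t → t i < t m)).card ≤ 1 := by
    refine Finset.card_le_one.2 fun a ha b hb => ?_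
    by_contra hab
    rw [Finset.mem_filter] at ha hb
    have h1 : t b < t a := ha.2 b (Ne.symm hab) hb.1
    have h2 : t a < t b := hb.2 a hab ha.1
    exact lt_irrefl _ (h1.trans h2)
  exact_mod_cast h

/-- At most one atom is a strict maximum. -/
theorem sum_maxInd_le_one (t : Fin 3 → ℝ) : ∑ m, maxInd t m ≤ 1 := by
  classical
  unfold maxInd
  rw [Finset.sum_boole]
  have h : (univ.filter (fun m : Fin 3 => ∀ i, i ≠ m → t i < t m)).card ≤ 1 := by
    refine Finset.card_le_one.2 fun a ha b hb => ?_
    by_contra hab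
    rw [Finset.mem_filter] at ha hb
    have h1 : t b < t a := ha.2 b (Ne.symm hab)
    have h2 : t a < t b := hb.2 a hab
    exact lt_irrefl _ (h1.trans h2)
  exact_mod_cast h

/-- A minimal atom is above nobody, so at most two atoms are above somebody. -/
theorem sum_notMinInd_le_two (t : Fin 3 → ℝ) : ∑ m, notMinInd t m ≤ 2 := by
  classical
  unfold notMinInd
  rw [Finset.sum_boole]
  obtain ⟨m₀, -, hm₀⟩ := Finset.exists_min_image univ t univ_nonempty
  have hsub : univ.filter (fun m : Fin 3 => ∃ i, i ≠ m ∧ t i < t m) ⊆ univ.erase m₀ := by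
    intro m hm
    rw [Finset.mem_filter] at hm
    rw [Finset.mem_erase]
    refine ⟨?_, Finset.mem_univ _⟩
    rintro rfl
    obtain ⟨i, -, hi⟩ := hm.2
    exact absurd (hm₀ i (Finset.mem_univ _)) (not_le.2 hi)
  have hcard : (univ.erase m₀ : Finset (Fin 3)).card = 2 := by
    rw [Finset.card_erase_of_mem (Finset.mem_univ _), Finset.card_univ, Fintype.card_fin]
  have h := (Finset.card_le_card hsub).trans hcard.le
  exact_mod_cast h

/-! ### Positivity on active atoms (conjunct 2 of the stub) -/

/-- Indicators are nonnegative. -/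
theorem topInd_nonneg (ε : ℝ) (t : Fin 3 → ℝ) (m : Fin 3) : 0 ≤ topInd ε t m := by
  unfold topInd; split_ifs <;> norm_num

/-- Indicators are nonnegative. -/
theorem maxInd_nonneg (t : Fin 3 → ℝ) (m : Fin 3) : 0 ≤ maxInd t m := by
  unfold maxInd; split_ifs <;> norm_num

/-- Indicators are nonnegative. -/
theorem notMinInd_nonneg (t : Fin 3 → ℝ) (m : Fin 3) : 0 ≤ notMinInd t m := by
  unfold notMinInd; split_ifs <;> norm_num

/-- **Positivity** (conjunct 2 of `stub_cwCertsHigh` for this family, in its exact form): if `0 < Λ`,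
`Λ/2 ≤ c < Λ`, `αS, d₁, d₀ ≥ 0` and `β > 0`, the weight of an atom with `t_m > 0` is positive. -/
theorem weight_pos {ε Λ : ℝ} {c αS d₁ d₀ β : ℝ → ℝ} (hΛ : 0 < Λ) (hc : ∀ σ, Λ / 2 ≤ c σ)
    (hc' : ∀ σ, c σ < Λ) (hαS : ∀ σ, 0 ≤ αS σ) (hd₁ : ∀ σ, 0 ≤ d₁ σ) (hd₀ : ∀ σ, 0 ≤ d₀ σ)
    (hβ : ∀ σ, 0 < β σ) :
    ∀ m (t : Fin 3 → ℝ), 0 < t m → ∑ i ∈ univ.erase m, t i ≤ 1 - ε →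
      0 < weight ε Λ c αS d₁ d₀ β m t := by
  intro m t htm _
  unfold weight
  split_ifs with h1 h2
  · exact hΛ
  · have h3 : 0 ≤ (2 * c (∑ i, t i) - Λ) * topInd ε t m :=
      mul_nonneg (by linarith [hc (∑ i, t i)]) (topInd_nonneg ε t m)
    linarith [hc' (∑ i, t i)]
  · have h3 : 0 < β (∑ i, t i) * t m := mul_pos (hβ _) htm
    have h4 : 0 ≤ d₁ (∑ i, t i) * notMinInd t m := mul_nonneg (hd₁ _) (notMinInd_nonneg t m)
    have h5 : 0 ≤ d₀ (∑ i, t i) * maxInd t m := mul_nonneg (hd₀ _) (maxInd_nonneg t m)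
    linarith [hαS (∑ i, t i)]

/-! ### The pointwise bound (conjunct 4 of the stub) -/

/-- **Pointwise bound** (conjunct 4 of `stub_cwCertsHigh` for this family, in its exact form — the hypotheses
`t ≥ 0`, `∑ t ≤ 1 + ε` of the stub are not even needed): if `0 ≤ Λ`, `Λ/2 ≤ c σ`, `d₁, d₀ ≥ 0` and
`3 αS σ + β σ · σ + 2 d₁ σ + d₀ σ ≤ Λ` for all `σ`, then `∑_m 1[m active] · w_m(t) ≤ Λ` for every `t`.
Cases on the number of active atoms: `≤ 1`: at most one term `Λ`; `2`: `2(Λ - c) + (2c - Λ)·(≤ 1)`;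
`3`: `3 αS + β σ + d₁·(≤ 2) + d₀·(≤ 1)`. -/
theorem sum_indicator_weight_le {ε Λ : ℝ} {c αS d₁ d₀ β : ℝ → ℝ} (hΛ : 0 ≤ Λ) (hc : ∀ σ, Λ / 2 ≤ c σ)
    (hd₁ : ∀ σ, 0 ≤ d₁ σ) (hd₀ : ∀ σ, 0 ≤ d₀ σ)
    (hflat : ∀ σ, 3 * αS σ + β σ * σ + 2 * d₁ σ + d₀ σ ≤ Λ) :
    ∀ t : Fin 3 → ℝ, (∀ i, 0 ≤ t i) → ∑ i, t i ≤ 1 + ε →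
      ∑ m, (if 0 < t m ∧ ∑ i ∈ univ.erase m, t i ≤ 1 - ε then weight ε Λ c αS d₁ d₀ β m t else 0) ≤ Λ := by
  classical
  intro t _ _
  have key : ∑ m, (if 0 < t m ∧ ∑ i ∈ univ.erase m, t i ≤ 1 - ε then weight ε Λ c αS d₁ d₀ β m t else 0) =
      ∑ m ∈ actSet ε t, weight ε Λ c αS d₁ d₀ β m t := by
    rw [actSet, Finset.sum_filter]
  rw [key]
  set s := actSet ε t with hs
  set σ := ∑ i, t i with hσ
  have hcard3 : s.card ≤ 3 := by
    simpa using Finset.card_le_univ s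
  by_cases h1 : s.card ≤ 1
  · -- at most one active atom, each weighing `Λ`
    have hw : ∀ m ∈ s, weight ε Λ c αS d₁ d₀ β m t = Λ := by
      intro m _; unfold weight; rw [if_pos h1]
    rw [Finset.sum_congr rfl hw, Finset.sum_const, nsmul_eq_mul]
    have : (s.card : ℝ) ≤ 1 := by exact_mod_cast h1
    nlinarith
  by_cases h2 : s.card = 2
  · -- two active atoms
    have hw : ∀ m ∈ s, weight ε Λ c αS d₁ d₀ β m t = (Λ - c σ) + (2 * c σ - Λ) * topInd ε t m := by
      intro m _; unfold weight; rw [if_neg h1, if_pos h2]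
    rw [Finset.sum_congr rfl hw, Finset.sum_add_distrib, Finset.sum_const, nsmul_eq_mul, ← Finset.mul_sum, h2]
    have htop := sum_topInd_le_one ε t
    have hpos : 0 ≤ 2 * c σ - Λ := by linarith [hc σ]
    have := mul_le_mul_of_nonneg_left htop hpos
    push_cast
    linarith
  · -- three active atoms: `s = univ`
    have h3 : s.card = 3 := by omega
    have hsu : s = univ := Finset.eq_univ_of_card s (by rw [h3, Fintype.card_fin])
    have hw : ∀ m ∈ s, weight ε Λ c αS d₁ d₀ β m t =
        αS σ + β σ * t m + d₁ σ * notMinInd t m + d₀ σ * maxInd t m := by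
      intro m _; unfold weight; rw [if_neg h1, if_neg h2]
    rw [Finset.sum_congr rfl hw, hsu]
    simp only [Finset.sum_add_distrib, Finset.sum_const, Finset.card_univ, Fintype.card_fin, nsmul_eq_mul,
      ← Finset.mul_sum]
    have hA := sum_notMinInd_le_two t
    have hB := sum_maxInd_le_one t
    have h4 := mul_le_mul_of_nonneg_left hA (hd₁ σ)
    have h5 := mul_le_mul_of_nonneg_left hB (hd₀ σ)
    push_cast
    linarith [hflat σ]

/-! ### Measurability (conjunct 1 of the stub) -/

section Measurability

open MeasureTheory

/-- The activity condition of atom `i` cuts out a measurable set. -/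
theorem measurableSet_act (ε : ℝ) (i : Fin 3) :
    MeasurableSet {t : Fin 3 → ℝ | 0 < t i ∧ ∑ j ∈ univ.erase i, t j ≤ 1 - ε} :=
  (measurableSet_lt measurable_const (measurable_pi_apply i)).inter
    (measurableSet_le (Finset.measurable_sum _ fun j _ => measurable_pi_apply j) measurable_const)

/-- Membership in the active set. -/
theorem mem_actSet {ε : ℝ} {t : Fin 3 → ℝ} {i : Fin 3} :
    i ∈ actSet ε t ↔ 0 < t i ∧ ∑ j ∈ univ.erase i, t j ≤ 1 - ε := by
  classical
  simp [actSet]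

/-- The number of active atoms, as a real number, is a sum of indicators. -/
theorem card_actSet_eq (ε : ℝ) (t : Fin 3 → ℝ) :
    ((actSet ε t).card : ℝ) = ∑ i, if 0 < t i ∧ ∑ j ∈ univ.erase i, t j ≤ 1 - ε then (1:ℝ) else 0 := by
  classical
  rw [actSet, Finset.natCast_card_filter]

/-- The number of active atoms is a measurable function of `t`. -/
theorem measurable_card_actSet (ε : ℝ) : Measurable fun t : Fin 3 → ℝ => ((actSet ε t).card : ℝ) := by
  classical
  have h : (fun t : Fin 3 → ℝ => ((actSet ε t).card : ℝ)) =
      fun t => ∑ i, if 0 < t i ∧ ∑ j ∈ univ.erase i, t j ≤ 1 - ε then (1:ℝ) else 0 := by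
    funext t; exact card_actSet_eq ε t
  rw [h]
  exact Finset.measurable_sum _ fun i _ =>
    Measurable.ite (measurableSet_act ε i) measurable_const measurable_const

/-- `{t | #active ≤ 1}` is measurable. -/
theorem measurableSet_card_le_one (ε : ℝ) :
    MeasurableSet {t : Fin 3 → ℝ | (actSet ε t).card ≤ 1} := by
  have h : {t : Fin 3 → ℝ | (actSet ε t).card ≤ 1} = {t | ((actSet ε t).card : ℝ) ≤ 1} := by
    ext t; simp only [Set.mem_setOf_eq]; norm_cast
  rw [h]
  exact measurableSet_le (measurable_card_actSet ε) measurable_const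

/-- `{t | #active = 2}` is measurable. -/
theorem measurableSet_card_eq_two (ε : ℝ) :
    MeasurableSet {t : Fin 3 → ℝ | (actSet ε t).card = 2} := by
  have h : {t : Fin 3 → ℝ | (actSet ε t).card = 2} = {t | ((actSet ε t).card : ℝ) = 2} := by
    ext t; simp only [Set.mem_setOf_eq]; norm_cast
  rw [h]
  exact measurableSet_eq_fun (measurable_card_actSet ε) measurable_const

/-- The condition of `topInd` cuts out a measurable set. -/
theorem measurableSet_topCond (ε : ℝ) (m : Fin 3) :
    MeasurableSet {t : Fin 3 → ℝ | ∀ i, i ≠ m → i ∈ actSet ε t → t i < t m} := by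
  have h : {t : Fin 3 → ℝ | ∀ i, i ≠ m → i ∈ actSet ε t → t i < t m} =
      ⋂ i ∈ (univ.erase m : Finset (Fin 3)),
        ({t : Fin 3 → ℝ | 0 < t i ∧ ∑ j ∈ univ.erase i, t j ≤ 1 - ε}ᶜ ∪ {t | t i < t m}) := by
    ext t
    simp only [Set.mem_setOf_eq, Set.mem_iInter, Set.mem_union, Set.mem_compl_iff, Finset.mem_erase,
      Finset.mem_univ, and_true, mem_actSet]
    constructor
    · intro h i hi
      by_cases hc : 0 < t i ∧ ∑ j ∈ univ.erase i, t j ≤ 1 - ε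
      · exact Or.inr (h i hi hc)
      · exact Or.inl hc
    · intro h i hi hc
      rcases h i hi with h' | h'
      · exact absurd hc h'
      · exact h'
  rw [h]
  exact Finset.measurableSet_biInter _ fun i _ =>
    (measurableSet_act ε i).compl.union (measurableSet_lt (measurable_pi_apply i) (measurable_pi_apply m))

/-- The condition of `maxInd` cuts out a measurable set. -/
theorem measurableSet_maxCond (m : Fin 3) :
    MeasurableSet {t : Fin 3 → ℝ | ∀ i, i ≠ m → t i < t m} := by
  have h : {t : Fin 3 → ℝ | ∀ i, i ≠ m → t i < t m} =
      ⋂ i ∈ (univ.erase m : Finset (Fin 3)), {t : Fin 3 → ℝ | t i < t m} := by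
    ext t
    simp only [Set.mem_setOf_eq, Set.mem_iInter, Finset.mem_erase, Finset.mem_univ, and_true]
  rw [h]
  exact Finset.measurableSet_biInter _ fun i _ =>
    measurableSet_lt (measurable_pi_apply i) (measurable_pi_apply m)

/-- The condition of `notMinInd` cuts out a measurable set. -/
theorem measurableSet_notMinCond (m : Fin 3) :
    MeasurableSet {t : Fin 3 → ℝ | ∃ i, i ≠ m ∧ t i < t m} := by
  have h : {t : Fin 3 → ℝ | ∃ i, i ≠ m ∧ t i < t m} =
      ⋃ i ∈ (univ.erase m : Finset (Fin 3)), {t : Fin 3 → ℝ | t i < t m} := by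
    ext t
    simp only [Set.mem_setOf_eq, Set.mem_iUnion, Finset.mem_erase, Finset.mem_univ, and_true, exists_prop]
  rw [h]
  exact Finset.measurableSet_biUnion _ fun i _ =>
    measurableSet_lt (measurable_pi_apply i) (measurable_pi_apply m)

/-- `topInd` is measurable in `t`. -/
theorem measurable_topInd (ε : ℝ) (m : Fin 3) : Measurable fun t : Fin 3 → ℝ => topInd ε t m := by
  unfold topInd
  exact Measurable.ite (measurableSet_topCond ε m) measurable_const measurable_const

/-- `maxInd` is measurable in `t`. -/
theorem measurable_maxInd (m : Fin 3) : Measurable fun t : Fin 3 → ℝ => maxInd t m := by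
  unfold maxInd
  exact Measurable.ite (measurableSet_maxCond m) measurable_const measurable_const

/-- `notMinInd` is measurable in `t`. -/
theorem measurable_notMinInd (m : Fin 3) : Measurable fun t : Fin 3 → ℝ => notMinInd t m := by
  unfold notMinInd
  exact Measurable.ite (measurableSet_notMinCond m) measurable_const measurable_const

/-- **Measurability** (conjunct 1 of `stub_cwCertsHigh` for this family, in its exact form): for measurable
parameter functions `c, αS, d₁, d₀, β`, every `w_m` is measurable. -/
theorem measurable_weight {ε Λ : ℝ} {c αS d₁ d₀ β : ℝ → ℝ} (hc : Measurable c) (hαS : Measurable αS)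
    (hd₁ : Measurable d₁) (hd₀ : Measurable d₀) (hβ : Measurable β) :
    ∀ m, Measurable (weight ε Λ c αS d₁ d₀ β m) := by
  intro m
  have hσ : Measurable fun t : Fin 3 → ℝ => ∑ i, t i :=
    Finset.measurable_sum _ fun i _ => measurable_pi_apply i
  have hcσ : Measurable fun t : Fin 3 → ℝ => c (∑ i, t i) := hc.comp hσ
  have h2 : Measurable fun t : Fin 3 → ℝ =>
      (Λ - c (∑ i, t i)) + (2 * c (∑ i, t i) - Λ) * topInd ε t m :=
    (measurable_const.sub hcσ).add ((( hcσ.const_mul 2).sub measurable_const).mul (measurable_topInd ε m))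
  have h3 : Measurable fun t : Fin 3 → ℝ =>
      αS (∑ i, t i) + β (∑ i, t i) * t m + d₁ (∑ i, t i) * notMinInd t m + d₀ (∑ i, t i) * maxInd t m :=
    (((hαS.comp hσ).add ((hβ.comp hσ).mul (measurable_pi_apply m))).add
      ((hd₁.comp hσ).mul (measurable_notMinInd m))).add ((hd₀.comp hσ).mul (measurable_maxInd m))
  unfold weight
  exact Measurable.ite (measurableSet_card_le_one ε) measurable_const
    (Measurable.ite (measurableSet_card_eq_two ε) h2 h3)

end Measurability

end RankActivity

end Summit.Parity.GeneralizedHardyLittlewood.Theses.PolymathEpsThreeCeiling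

end
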